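import Literature.MathematicalPhysics.QuantumFieldTheory.Balaban1983to89.B2Eq293ExternalField
import Literature.MathematicalPhysics.QuantumFieldTheory.Balaban1983to89.B2Eq324NestedRegions

/-!
# `Balaban1983to89.B2Eq32FieldRegularity` — [Balaban1982Higgs2] (3.2)–(3.4) p. 583: the §3 external vector field
`Ã^ε = (1 − θ₁)A₀ + Σ_{k=1}^{K−1}(1 − θ_{k+1})θ_kA^{(k),ε} + θ_KA^{(K),ε}` on the bonds of the ε-torus of the concrete
`HiggsLattice` carrier, and ITS REGULARITY ON THE BLOCKS `Bᵏ(Λ_k)`, `Λ_k = Λ₅⁽ᵏ⁻¹⁾′ ∩ Λ₅⁽ᵏ⁾ᶜ`, `k = 1, …, K` — the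
hypothesis `hreg` of the cell's (3.29)/(3.26) theorems `B2Ineq329RegularField.{ineq329_regular_concrete, prop31_regular_concrete}`
— DERIVED by the printed mechanism (2.95)–(2.98) pp. 576–577 (p15's `B2Eq293ExternalField`, BY NAME) from the printed
inputs: the geometry of the cut-offs `θ_k` (p. 567), Lemma 2.3 (2.59)/(2.60) p. 571 for `A^{(k),ε}`, `A^{(k+1),ε}`, and the
restriction (2.17)/(2.97) on `A_{k+1}(y′) − A_k(y)`

statement-level skeleton of published theorems with citation tags; proofs where landed; nothing here is a claim about the Yang–Mills mass gap

CITATION HEADER.  T. Bałaban, *(Higgs)₂,₃ quantum fields in a finite volume. II. An upper bound*, Commun. Math. Phys. **86**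
(1982) 555–594 [Balaban1982Higgs2] (PDF held `paper:balaban1982-cmp86-higgs23-ii`, journal page = PDF page + 554; pp. 583,
567, 571, 576–577, 586, 589–590 READ AS IMAGES on the ×2 renders
`run/shared/lean/pub/pub-balaban/b2b-balaban-ref1/pages/1982-cmp86-higgs23-II/1982-cmp86-higgs23-II-p029/p013/p017/p022/p023/p032/p035/p036-x2.png`).
Cell `lit-balaban` (HOME `run/shared/lean/pub/lit-balaban/`), Phase-2 proof seat **p23** gen 10 (unit `lit-balaban-p23-g10`);
SKELETON rows **B2.Prop3.1** / **B2.Eq3.29** (owner r02, second reader r14, referee ref-4): this is item (d1) of the «flip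
condition» recorded in HOME/GAPS.md G-B2-07 (ix) (r14 g10) and r02's HEAD CRITERION (2026-08-21T21:31Z) — the regularity
modulus `δ_k` of `B2Prop31RegularFamily.RMulti.restricted` is no longer to be ASSUMED for `Ã^ε` but DERIVED from the
structure (3.2)–(3.4) of `Ã^ε` and the printed thresholds.  Companion (same seat, same gen): `B2Prop31PrintedRestrictions`
(the family over printed thresholds, items (d2)–(d3)).  PRECEDENTS BY NAME, NOT RESTATED: r14's (2.51) carrier
`B2Sect2BDensities.{aTilde251, Nested}`; p15's `B2Eq293ExternalField.{aTilde251_tail, aTilde251_eq_top, aTilde251_eq_single,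
eq296_exact}` ((2.93)–(2.96)); p15's region tower `B2Eq324NestedRegions.Tower` and `B2Eq328ConcretePieces.pieceF`
(`Bᵏ(Λ_k) ⊂ T_ε`).

WHAT IS PRINTED.  p. 583 [PDF 29], verbatim: *"Finally in the expressions with scalar fields we have the following external
vector field  Ã^ε = (1 − θ₁)A₀ + Σ_{k=1}^{K−1}(1 − θ_{k+1})θ_kA^{(k),ε} + θ_KA^{(K),ε},  (3.2)  where the fields A^{(k),ε} are
defined by  A^{(k),ε} = a_k(Lᵏε)^{−2}ζ^{(k)}G^ε_kQ*_kA_k.  (3.3)  Also let us denote  Ã^{(k),ε} = Σ_{l=k}^{K−1}(1 − θ_{l+1})θ_lA^{(l),ε}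
+ θ_KA^{(K),ε}.  (3.4)"*; p. 567 [PDF 13]: *"The function θ_k is defined on T_η, is equal to 1 on B^{k−1}(Λ₂^{(k−1)}) and varies
"smoothly" from 1 to 0 on a slice of thickness < M surrounding B^{k−1}(Λ₂^{(k−1)})."*; Lemma 2.3 p. 571 [PDF 17]: *"Under the
restrictions (2.55), we have  A^{(k)}(x) = A(y) + O(p(Lᵏε)) = (Q*_kA)(x) + O(p(Lᵏε)),  x ∈ Bᵏ(y), y ∈ Λ₂^{(k−1)′},  (2.59)
(∂^η_μA^{(k)})(x) = O(p(Lᵏε)),  x ∈ Bᵏ(Λ₂^{(k−1)′}).  (2.60)"* and *"The inequalities of Lemma 2.3 will be applied also when a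
scale is changed."*; pp. 576–577 [PDF 22–23], the mechanism: *"The derivative (∂B̃)(x) of this configuration is equal to one
of the derivatives (∂A^{(l)})(x) … if the point x does not lie in a slice of thickness M surrounding one of the sets Bˡ(Λ₂^{(l)})
… (2.95) If x belongs to this slice, then … (∂B̃)(x) = (∂θ_{l+1})(x)(A^{(l+1)}(x) − A^{(l)}(x)) + O(p(Lʲε)),  (2.96) and applying
Lemma 2.3, we have A^{(l+1)}(x) − A^{(l)}(x) = A_{l+1}(y′) − A_l(y) + (L^{j−l})^{(d−2)/2}O(p(Lˡε)),  (2.97) where x ∈ B^{l+1}(y′),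
x ∈ Bˡ(y), thus y ∈ B(y′) and the restrictions on the fields A_l, A_{l+1} on the set Λ₀^{(l)} imply A_{l+1}(y′) − A_l(y) =
(L^{j−l})^{(d−2)/2}O(p(Lˡε)) again. These inequalities give us finally |(∂B̃)(x)| ≦ O(1)p(Lʲε),  (2.98)"*; Prop. 3.1 p. 589:
*"for arbitrary configurations Ã^ε, Φ defined by the formulas (3.2), (3.3), (3.24), and satisfying the restrictions …"*;
p. 590: (3.29) holds *"for φ′_k, Ã^η satisfying suitable restrictions"* = [Balaban1983RegularityDecay] Prop. 3.1′ (1.21)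
`|(∂^η_μA)(x)| ≦ O(1)p(e)` — the regularity this file delivers.

THE GEOMETRY USED (print, pp. 558, 566–567, 588).  `Λ_k = Λ₅⁽ᵏ⁻¹⁾′ ∩ Λ₅⁽ᵏ⁾ᶜ` (p. 590).  Since `Λ₅⁽ᵏ⁻¹⁾ ⊂ Λ₂⁽ᵏ⁻¹⁾` ((2.8)) one has
`θ_k = 1` on `Bᵏ⁻¹(Λ₅⁽ᵏ⁻¹⁾) = Bᵏ(Λ₅⁽ᵏ⁻¹⁾′) ⊇ Bᵏ(Λ_k)`; since `Λ₂⁽ᵏ⁺¹⁾ ⊂ Λ₀⁽ᵏ⁺¹⁾ ⊂ Λ₇⁽ᵏ⁾′` (p. 566) lies deep inside `Λ₅⁽ᵏ⁾′`,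
the support of `θ_{k+2}` (an M-slice around `Bᵏ⁺¹(Λ₂⁽ᵏ⁺¹⁾)`) does not meet `Bᵏ(Λ₅⁽ᵏ⁾ᶜ) ⊇ Bᵏ(Λ_k)`.  Hence ON `Bᵏ(Λ_k)` the
nested coefficients of (3.2) leave exactly `Ã^ε = (1 − θ_{k+1})A^{(k),ε} + θ_{k+1}A^{(k+1),ε}` (`field32_eq_two`; the slice of
`θ_{k+1}` around `Bᵏ(Λ₂⁽ᵏ⁾)` crosses `Bᵏ(Λ_k)`), and for `k = K` (`Λ₅⁽ᴷ⁾ = ∅`, p. 588) `Ã^ε = A^{(K),ε}` (`field32_eq_top`).  These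
two inclusions are the HYPOTHESES `hone`/`hzero` below, phrased on the tower `B2Eq324NestedRegions.Tower` (`lamAt k z` ↤
`z ∈ Bᵏ(Λ₅⁽ᵏ⁾)`) with a one-fine-step margin (the difference quotient looks at `z` and `z + εe_ν`).

DICTIONARY (print ↦ Lean; everything on the physical ε-torus `T_ε` of `HiggsLattice`, no rescaling).  `θ_k` ↦ `θ k : Site P 0 → ℝ`
(a cut-off on the fine torus; it multiplies a bond variable through the bond's initial point: `thetaB θ k ⟨z, μ⟩ = θ k z` — a
READING, print does not say at which end of a bond `θ_k` is evaluated); `A₀`, `A^{(k),ε}` ↦ `A₀`, `A k : VecField P 0` (the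
minimizers (3.3) are DATA here: their definition via `G^ε_kQ*_k` is not used, only Lemma 2.3's conclusions about them);
`Ã^ε` (3.2) ↦ `field32 θ A₀ A K = aTilde251 (thetaB θ) A₀ A K` (r14's (2.51) at `k = K`: (3.2) IS (2.51) with K steps);
`Ã^{(k),ε}` (3.4) ↦ `field34 θ A k K`; `A_k(y)` (the block field at `y ∈ T⁽ᵏ⁾`, μ-component) ↦ reference values `ak z μ`
attached to the fine bond (`= A_k(⟨y, y + Lᵏεe_μ⟩)`, `y = z_k`); the fine difference `Ã(⟨z + εe_ν, μ⟩) − Ã(⟨z, μ⟩)` is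
`ε·(∂^ε_νÃ_μ)(z)`, so every bound below is `ε ×` the printed difference-quotient bound (the companion file supplies the
printed thresholds in these physical units).

WHAT THIS MODULE PROVES (kernel-checked, 0 `sorry`, standard axioms; the three `def`s have bodies; no `Prop`-valued fact).
 §1 (3.2)/(3.4): `thetaB`, `field32`, `field34`, `nested_thetaB`, **`field32_apply`** (= the printed display (3.2)),
    **`field32_eq_field34`** ((3.2) = (3.4) where `θ_k = 1`), `field32_eq_two`, `field32_eq_top`, `field32_sub_offSlice`.
 §2 the regularity on a set `S` of fine sites carrying the slice pattern (`θ_k = 1`, `θ_{k+2} = 0` at `z` and `z + εe_ν`):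
    **`field32_regular_slice`** — `|Ã(⟨z+εe_ν,μ⟩) − Ã(⟨z,μ⟩)| ≤ ϑ(α + α′ + β) + max(γ, γ′)` from (2.59) at the two levels
    (`α`, `α′`), the restriction (2.17)/(2.97) (`β`), (2.60) at the two levels (`γ`, `γ′`), `|∂θ_{k+1}| ≤ ϑ`, `0 ≤ θ_{k+1} ≤ 1`,
    the level-`(k+1)` inputs being required ONLY where `θ_{k+1} ≠ 0` at `z` or `z + εe_ν` (the slice; off it (2.95) applies:
    `field32_sub_offSlice`); **`field32_regular_top`** (`k = K`: `= |A^{(K)}(⟨z+εe_ν,μ⟩) − A^{(K)}(⟨z,μ⟩)| ≤ γ`).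
 §3 on the tower: `slice_pattern_of_tower` (the pattern on `Bᵏ(Λ_k)` from `hone`/`hzero`/`habove`) and
    **`field32_regular_tower`** — for EVERY `j : Fin K` (`k = j + 1`) and every `z ∈ pieceF T.regions j = Bᵏ(Λ_k)`,
    `|Ã^ε(⟨z+εe_ν,μ⟩) − Ã^ε(⟨z,μ⟩)| ≤ δ_j` whenever `ϑ_j(α_j + α′_j + β_j) + max(γ_j, γ′_j) ≤ δ_j` — EXACTLY the hypothesis
    `hreg` of `B2Ineq329RegularField.prop31_regular_concrete` / `prop31_regular_tower`.
HONEST SCOPE.  (i) Lemma 2.3 (row B2.Lem2.3; proved for Bałaban's torus operators in `B2Lemma23Torus` on `Setup`'s tori, not on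
this carrier) is NOT re-derived: its conclusions (2.59)/(2.60) for `A^{(k),ε}` and — on the `θ_{k+1}`-slice — for `A^{(k+1),ε}`
enter as hypotheses in printed shape, as does the restriction on `A_{k+1}(y′) − A_k(y)` and `|∂θ| ≤ O(1)`; print applies
Lemma 2.3 on the slice (2.97) although (2.59)–(2.60) are displayed on `Bᵏ⁺¹(Λ₂⁽ᵏ⁾′)` only (the same proof covers
`Bᵏ⁺¹(Λ₁⁽ᵏ⁾′) ⊃` the slice) — we follow print.  (ii) The two inclusions of THE GEOMETRY USED are hypotheses on the cut-offs
relative to the tower (`hone`, `hzero`), not derived from a construction of `θ_k` (none is fixed in print beyond p. 567).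
(iii) `θ_k` acts on a bond through its initial point (READING).  (iv) `θ_k := 0` for `k > K` (`habove`; (3.2) does not involve
them) so that the two-scale lemma applies at `k = K − 1`.  (v) (3.3) itself (the formula for `A^{(k),ε}`) is quoted, not built.
-/

noncomputable section

open Finset

namespace Literature.MathematicalPhysics.QuantumFieldTheory.Balaban1983to89.B2Eq32FieldRegularity

open Literature.MathematicalPhysics.QuantumFieldTheory.Balaban1983to89.HiggsLattice
open Literature.MathematicalPhysics.QuantumFieldTheory.Balaban1983to89.HiggsAveraging
open Literature.MathematicalPhysics.QuantumFieldTheory.Balaban1983to89.B2Eq337ScalarIntegration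
open Literature.MathematicalPhysics.QuantumFieldTheory.Balaban1983to89.B2Eq328ConcretePieces
open Literature.MathematicalPhysics.QuantumFieldTheory.Balaban1983to89.B2Eq324NestedRegions
open B2Sect2BDensities (aTilde251 Nested)
open B2Eq293ExternalField

variable {P : HiggsLattice.Params}

/-! ## §1 (3.2)–(3.4) p. 583 on the bonds of the ε-torus -/

section Defs

/-- The cut-off `θ_k` (a function on the fine torus `T_η`, p. 567) acting on bond variables through the bond's initial point:
`(θ_kA)(⟨z, z + εe_μ⟩) := θ_k(z)·A(⟨z, z + εe_μ⟩)` (READING). [cite: Balaban1982Higgs2, (3.2) p.583, p.567] -/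
def thetaB (θ : ℕ → HiggsLattice.Site P 0 → ℝ) (k : ℕ) : HiggsLattice.PBond P 0 → ℝ := fun b => θ k b.src

/-- **(3.2)** p. 583: the §3 external vector field `Ã^ε = (1 − θ₁)A₀ + Σ_{k=1}^{K−1}(1 − θ_{k+1})θ_kA^{(k),ε} + θ_KA^{(K),ε}` on the
bonds of `T_ε` — r14's (2.51) `aTilde251` with `K` steps (*"Ã^ε = (1 − θ₁)A₀ + Σ_{j=1}^{k−1}(1 − θ_{j+1})θ_jA^{(j),ε} + θ_kA^{(k),ε}"*,
(2.51) p. 569, at `k = K`). [cite: Balaban1982Higgs2, (3.2) p.583, (2.51) p.569] -/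
def field32 (θ : ℕ → HiggsLattice.Site P 0 → ℝ) (A₀ : HiggsLattice.VecField P 0) (A : ℕ → HiggsLattice.VecField P 0)
    (K : ℕ) : HiggsLattice.VecField P 0 :=
  aTilde251 (thetaB θ) A₀ A K

/-- **(3.4)** p. 583: `Ã^{(k),ε} = Σ_{l=k}^{K−1}(1 − θ_{l+1})θ_lA^{(l),ε} + θ_KA^{(K),ε}` (the scales `l ≥ k` of (3.2)).
[cite: Balaban1982Higgs2, (3.4) p.583] -/
def field34 (θ : ℕ → HiggsLattice.Site P 0 → ℝ) (A : ℕ → HiggsLattice.VecField P 0) (k K : ℕ) :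
    HiggsLattice.VecField P 0 :=
  fun b => (∑ l ∈ Ico k K, ((1 - θ (l + 1) b.src) * θ l b.src) * A l b) + θ K b.src * A K b

variable (θ : ℕ → HiggsLattice.Site P 0 → ℝ) (A₀ : HiggsLattice.VecField P 0) (A : ℕ → HiggsLattice.VecField P 0)

/-- Nesting of the cut-offs on sites (`θ_{j+1}θ_j = θ_{j+1}`, p. 567/569) gives nesting of their bond versions.
[cite: Balaban1982Higgs2, (2.51) p.569] -/
theorem nested_thetaB (hθ : Nested θ) : Nested (thetaB θ) := fun j b hj => hθ j b.src hj

/-- **(3.2) written out**: `Ã^ε(b) = (1 − θ₁(b₋))A₀(b) + Σ_{k=1}^{K−1}(1 − θ_{k+1}(b₋))θ_k(b₋)A^{(k),ε}(b) + θ_K(b₋)A^{(K),ε}(b)`.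
[cite: Balaban1982Higgs2, (3.2) p.583] -/
theorem field32_apply (K : ℕ) (b : HiggsLattice.PBond P 0) :
    field32 θ A₀ A K b = (1 - θ 1 b.src) * A₀ b
      + (∑ k ∈ Ico 1 K, ((1 - θ (k + 1) b.src) * θ k b.src) * A k b) + θ K b.src * A K b := by
  simp [field32, aTilde251, thetaB, smul_eq_mul]

/-- **(3.2) = (3.4) on `{θ_k = 1}`** (`1 ≤ k ≤ K`): where `θ_k(b₋) = 1` (hence `θ_l(b₋) = 1` for `l ≤ k`, nesting) the scales
`< k` of (3.2) drop out and `Ã^ε(b) = Ã^{(k),ε}(b)` — p15's `aTilde251_tail`. [cite: Balaban1982Higgs2, (3.2)–(3.4) p.583] -/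
theorem field32_eq_field34 (hθ : Nested θ) {k K : ℕ} (hk : 1 ≤ k) (hkK : k ≤ K) (b : HiggsLattice.PBond P 0)
    (h1 : θ k b.src = 1) : field32 θ A₀ A K b = field34 θ A k K b := by
  obtain ⟨j, rfl⟩ : ∃ j, k = j + 1 := ⟨k - 1, by omega⟩
  have h := aTilde251_tail (nested_thetaB θ hθ) A₀ A (show j + 1 ≤ K from hkK) (x := b) (by simpa [thetaB] using h1)
  simpa [field32, field34, thetaB, smul_eq_mul] using h

/-- **The two-scale form on the `θ_{k+1}`-slice** (`1 ≤ k`, `k + 1 ≤ K`): where `θ_k(b₋) = 1` and `θ_{k+2}(b₋) = 0`,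
`Ã^ε(b) = (1 − θ_{k+1}(b₋))A^{(k),ε}(b) + θ_{k+1}(b₋)A^{(k+1),ε}(b)` — p15's `aTilde251_eq_two` ((2.96) p. 576).
[cite: Balaban1982Higgs2, (3.2) p.583, (2.96) p.576] -/
theorem field32_eq_two (hθ : Nested θ) {k K : ℕ} (hk : 1 ≤ k) (hkK : k + 1 ≤ K) (b : HiggsLattice.PBond P 0)
    (h1 : θ k b.src = 1) (h0 : θ (k + 2) b.src = 0) :
    field32 θ A₀ A K b = (1 - θ (k + 1) b.src) * A k b + θ (k + 1) b.src * A (k + 1) b := by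
  have h := aTilde251_eq_two (nested_thetaB θ hθ) A₀ A hk hkK (x := b) (by simpa [thetaB] using h1)
    (by simpa [thetaB] using h0)
  simpa [field32, thetaB, smul_eq_mul] using h

/-- **The top scale** (`1 ≤ K`): where `θ_K(b₋) = 1`, `Ã^ε(b) = A^{(K),ε}(b)` — p15's `aTilde251_eq_top`; on `Bᴷ(Λ_K)`,
`Λ_K = Λ₅⁽ᴷ⁻¹⁾′` (*"where Λ₅⁽ᴷ⁾ = ∅"*, p. 588). [cite: Balaban1982Higgs2, (3.2) p.583, (3.23) p.588] -/
theorem field32_eq_top (hθ : Nested θ) {K : ℕ} (hK : 1 ≤ K) (b : HiggsLattice.PBond P 0) (h1 : θ K b.src = 1) :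
    field32 θ A₀ A K b = A K b := by
  have h := aTilde251_eq_top (nested_thetaB θ hθ) A₀ A hK (x := b) (by simpa [thetaB] using h1)
  simpa [field32] using h

/-- **(2.95), first equality, for (3.2)**: along a fine bond pair `⟨z,μ⟩`, `⟨z+εe_ν,μ⟩` OFF the slices — `θ_k = 1` and
`θ_{k+1} = 0` at both `z` and `z + εe_ν` (`1 ≤ k < K`) — the difference of `Ã^ε` IS the difference of the single field
`A^{(k),ε}` (p15's `aTilde251_eq_single`). [cite: Balaban1982Higgs2, (2.95) p.576, (3.2) p.583] -/
theorem field32_sub_offSlice (hθ : Nested θ) {k K : ℕ} (hk : 1 ≤ k) (hkK : k < K) (z : HiggsLattice.Site P 0)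
    (μ ν : Fin P.d) (h1 : θ k z = 1) (h0 : θ (k + 1) z = 0) (h1' : θ k (z.shift ν) = 1)
    (h0' : θ (k + 1) (z.shift ν) = 0) :
    field32 θ A₀ A K ⟨z.shift ν, μ⟩ - field32 θ A₀ A K ⟨z, μ⟩ = A k ⟨z.shift ν, μ⟩ - A k ⟨z, μ⟩ := by
  have e1 := aTilde251_eq_single (nested_thetaB θ hθ) A₀ A hk hkK (x := (⟨z, μ⟩ : HiggsLattice.PBond P 0))
    (by simpa [thetaB] using h1) (by simpa [thetaB] using h0)
  have e2 := aTilde251_eq_single (nested_thetaB θ hθ) A₀ A hk hkK (x := (⟨z.shift ν, μ⟩ : HiggsLattice.PBond P 0))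
    (by simpa [thetaB] using h1') (by simpa [thetaB] using h0')
  simp only [field32, e1, e2]

end Defs

/-! ## §2 The regularity of (3.2) on a set carrying the slice pattern — (2.96)–(2.98) pp. 576–577 -/

section Regular

variable (θ : ℕ → HiggsLattice.Site P 0 → ℝ) (A₀ : HiggsLattice.VecField P 0) (A : ℕ → HiggsLattice.VecField P 0)

/-- **(2.97)–(2.98) for (3.2) on the `θ_{k+1}`-slice** (`1 ≤ k`, `k + 1 ≤ K`): at a fine site `z` with the slice pattern
`θ_k = 1`, `θ_{k+2} = 0` at `z` and at `z + εe_ν`, and `0 ≤ θ_{k+1}(z + εe_ν) ≤ 1`, `|θ_{k+1}(z+εe_ν) − θ_{k+1}(z)| ≤ ϑ`; with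
(2.59) at the two levels `|A^{(k),ε}(⟨z,μ⟩) − a| ≤ α`, `|A^{(k+1),ε}(⟨z,μ⟩) − a′| ≤ α′` (`a = A_k(y)`, `a′ = A_{k+1}(y′)`, `z ∈ Bᵏ(y)`,
`z ∈ Bᵏ⁺¹(y′)`), the restriction `|a′ − a| ≤ β` (*"the restrictions on the fields A_l, A_{l+1} … imply A_{l+1}(y′) − A_l(y) = …
O(p(Lˡε))"*), and (2.60) at the two levels `|A^{(k),ε}(⟨z+εe_ν,μ⟩) − A^{(k),ε}(⟨z,μ⟩)| ≤ γ`, `|A^{(k+1),ε}(…) − A^{(k+1),ε}(…)| ≤ γ′`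
— the level-`(k+1)` data being required only when `θ_{k+1}(z) ≠ 0 ∨ θ_{k+1}(z+εe_ν) ≠ 0` — one has
`|Ã^ε(⟨z+εe_ν,μ⟩) − Ã^ε(⟨z,μ⟩)| ≤ ϑ(α + α′ + β) + max(γ, γ′)`: the product rule (2.96) (p15's `eq296_exact`) and the triangle
inequality (2.97). [cite: Balaban1982Higgs2, (2.96)–(2.98) pp.576–577, (3.2) p.583] -/
theorem field32_regular_slice (hθ : Nested θ) {k K : ℕ} (hk : 1 ≤ k) (hkK : k + 1 ≤ K) (z : HiggsLattice.Site P 0)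
    (μ ν : Fin P.d) (h1 : θ k z = 1) (h0 : θ (k + 2) z = 0) (h1' : θ k (z.shift ν) = 1) (h0' : θ (k + 2) (z.shift ν) = 0)
    (ht0 : 0 ≤ θ (k + 1) (z.shift ν)) (ht1 : θ (k + 1) (z.shift ν) ≤ 1) {ϑ α α' β γ γ' : ℝ} (hϑ : 0 ≤ ϑ)
    (hα : 0 ≤ α) (hα' : 0 ≤ α') (hβ : 0 ≤ β)
    (hdθ : |θ (k + 1) (z.shift ν) - θ (k + 1) z| ≤ ϑ) {a a' : ℝ}
    (h259 : |A k ⟨z, μ⟩ - a| ≤ α)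
    (h259' : (θ (k + 1) z ≠ 0 ∨ θ (k + 1) (z.shift ν) ≠ 0) → |A (k + 1) ⟨z, μ⟩ - a'| ≤ α')
    (hrestr : (θ (k + 1) z ≠ 0 ∨ θ (k + 1) (z.shift ν) ≠ 0) → |a' - a| ≤ β)
    (h260 : |A k ⟨z.shift ν, μ⟩ - A k ⟨z, μ⟩| ≤ γ)
    (h260' : (θ (k + 1) z ≠ 0 ∨ θ (k + 1) (z.shift ν) ≠ 0) →
      |A (k + 1) ⟨z.shift ν, μ⟩ - A (k + 1) ⟨z, μ⟩| ≤ γ') :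
    |field32 θ A₀ A K ⟨z.shift ν, μ⟩ - field32 θ A₀ A K ⟨z, μ⟩| ≤ ϑ * (α + α' + β) + max γ γ' := by
  -- the product rule (2.96), exact, on the bonds `x = ⟨z,μ⟩`, `x' = ⟨z+εe_ν,μ⟩`
  have hex := eq296_exact (nested_thetaB θ hθ) A₀ A hk hkK (x := (⟨z, μ⟩ : HiggsLattice.PBond P 0))
    (x' := (⟨z.shift ν, μ⟩ : HiggsLattice.PBond P 0)) (by simpa [thetaB] using h1) (by simpa [thetaB] using h0)
    (by simpa [thetaB] using h1') (by simpa [thetaB] using h0')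
  have hex' : field32 θ A₀ A K ⟨z.shift ν, μ⟩ - field32 θ A₀ A K ⟨z, μ⟩
      = (θ (k + 1) (z.shift ν) - θ (k + 1) z) * (A (k + 1) ⟨z, μ⟩ - A k ⟨z, μ⟩)
        + (1 - θ (k + 1) (z.shift ν)) * (A k ⟨z.shift ν, μ⟩ - A k ⟨z, μ⟩)
        + θ (k + 1) (z.shift ν) * (A (k + 1) ⟨z.shift ν, μ⟩ - A (k + 1) ⟨z, μ⟩) := by
    simpa [field32, thetaB, smul_eq_mul] using hex
  have hγ0 : 0 ≤ γ := le_trans (abs_nonneg _) h260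
  by_cases hsl : θ (k + 1) z ≠ 0 ∨ θ (k + 1) (z.shift ν) ≠ 0
  · -- in the slice: (2.97) by the triangle inequality
    have h259'' := h259' hsl
    have hrestr' := hrestr hsl
    have h260'' := h260' hsl
    set t' := θ (k + 1) (z.shift ν) with ht'
    set t := θ (k + 1) z with ht
    have h297 : |A (k + 1) ⟨z, μ⟩ - A k ⟨z, μ⟩| ≤ α + α' + β := by
      have hdec : A (k + 1) ⟨z, μ⟩ - A k ⟨z, μ⟩
          = (A (k + 1) ⟨z, μ⟩ - a') + (a' - a) + (a - A k ⟨z, μ⟩) := by ring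
      rw [hdec]
      have e3 : |a - A k ⟨z, μ⟩| ≤ α := by rw [abs_sub_comm]; exact h259
      calc |A (k + 1) ⟨z, μ⟩ - a' + (a' - a) + (a - A k ⟨z, μ⟩)|
          ≤ |A (k + 1) ⟨z, μ⟩ - a'| + |a' - a| + |a - A k ⟨z, μ⟩| := abs_add_three _ _ _
        _ ≤ α' + β + α := add_le_add (add_le_add h259'' hrestr') e3
        _ = α + α' + β := by ring
    have hA : |(t' - t) * (A (k + 1) ⟨z, μ⟩ - A k ⟨z, μ⟩)| ≤ ϑ * (α + α' + β) := by
      rw [abs_mul]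
      exact mul_le_mul hdθ h297 (abs_nonneg _) hϑ
    have hconv : |(1 - t') * (A k ⟨z.shift ν, μ⟩ - A k ⟨z, μ⟩) + t' * (A (k + 1) ⟨z.shift ν, μ⟩ - A (k + 1) ⟨z, μ⟩)|
        ≤ max γ γ' := by
      calc |(1 - t') * (A k ⟨z.shift ν, μ⟩ - A k ⟨z, μ⟩) + t' * (A (k + 1) ⟨z.shift ν, μ⟩ - A (k + 1) ⟨z, μ⟩)|
          ≤ |(1 - t') * (A k ⟨z.shift ν, μ⟩ - A k ⟨z, μ⟩)| + |t' * (A (k + 1) ⟨z.shift ν, μ⟩ - A (k + 1) ⟨z, μ⟩)| :=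
            abs_add_le _ _
        _ = (1 - t') * |A k ⟨z.shift ν, μ⟩ - A k ⟨z, μ⟩| + t' * |A (k + 1) ⟨z.shift ν, μ⟩ - A (k + 1) ⟨z, μ⟩| := by
            rw [abs_mul, abs_mul, abs_of_nonneg (by linarith), abs_of_nonneg ht0]
        _ ≤ (1 - t') * max γ γ' + t' * max γ γ' :=
            add_le_add (mul_le_mul_of_nonneg_left (h260.trans (le_max_left _ _)) (by linarith))
              (mul_le_mul_of_nonneg_left (h260''.trans (le_max_right _ _)) ht0)
        _ = max γ γ' := by ring
    rw [hex']
    calc |(t' - t) * (A (k + 1) ⟨z, μ⟩ - A k ⟨z, μ⟩) + (1 - t') * (A k ⟨z.shift ν, μ⟩ - A k ⟨z, μ⟩)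
          + t' * (A (k + 1) ⟨z.shift ν, μ⟩ - A (k + 1) ⟨z, μ⟩)|
        ≤ |(t' - t) * (A (k + 1) ⟨z, μ⟩ - A k ⟨z, μ⟩)|
          + |(1 - t') * (A k ⟨z.shift ν, μ⟩ - A k ⟨z, μ⟩) + t' * (A (k + 1) ⟨z.shift ν, μ⟩ - A (k + 1) ⟨z, μ⟩)| := by
          rw [add_assoc]; exact abs_add_le _ _
      _ ≤ ϑ * (α + α' + β) + max γ γ' := add_le_add hA hconv
  · -- off the slice: (2.95), one scale
    push Not at hsl
    obtain ⟨hz, hz'⟩ := hsl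
    rw [hex', hz, hz']
    have hbig : 0 ≤ ϑ * (α + α' + β) := mul_nonneg hϑ (by linarith)
    calc |(0 - 0) * (A (k + 1) ⟨z, μ⟩ - A k ⟨z, μ⟩) + (1 - 0) * (A k ⟨z.shift ν, μ⟩ - A k ⟨z, μ⟩)
          + 0 * (A (k + 1) ⟨z.shift ν, μ⟩ - A (k + 1) ⟨z, μ⟩)|
        = |A k ⟨z.shift ν, μ⟩ - A k ⟨z, μ⟩| := by ring_nf
      _ ≤ γ := h260
      _ ≤ ϑ * (α + α' + β) + max γ γ' := by linarith [le_max_left γ γ']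

/-- **The top scale `k = K`** (`1 ≤ K`): where `θ_K = 1` at `z` and `z + εe_ν`, `Ã^ε = A^{(K),ε}` and the regularity of `Ã^ε`
IS (2.60) for `A^{(K),ε}`. [cite: Balaban1982Higgs2, (2.60) p.571, (3.2) p.583] -/
theorem field32_regular_top (hθ : Nested θ) {K : ℕ} (hK : 1 ≤ K) (z : HiggsLattice.Site P 0) (μ ν : Fin P.d)
    (h1 : θ K z = 1) (h1' : θ K (z.shift ν) = 1) {γ : ℝ} (h260 : |A K ⟨z.shift ν, μ⟩ - A K ⟨z, μ⟩| ≤ γ) :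
    |field32 θ A₀ A K ⟨z.shift ν, μ⟩ - field32 θ A₀ A K ⟨z, μ⟩| ≤ γ := by
  rw [field32_eq_top θ A₀ A hθ hK ⟨z.shift ν, μ⟩ h1', field32_eq_top θ A₀ A hθ hK ⟨z, μ⟩ h1]
  exact h260

end Regular

/-! ## §3 On the tower of §3: the regularity of `Ã^ε` on every `Bᵏ(Λ_k)`, `k = 1, …, K` -/

section TowerReg

variable {K : ℕ} (T : Tower P K) (θ : ℕ → HiggsLattice.Site P 0 → ℝ) (A₀ : HiggsLattice.VecField P 0)
  (A : ℕ → HiggsLattice.VecField P 0)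

/-- **The slice pattern on `Bᵏ(Λ_k)` from the printed geometry of the cut-offs** (`k = j + 1`): if `θ_k = 1` on
`Bᵏ⁻¹(Λ₅⁽ᵏ⁻¹⁾)` and one fine step around it (`hone`; print: `θ_k = 1` on `Bᵏ⁻¹(Λ₂⁽ᵏ⁻¹⁾) ⊇ Bᵏ⁻¹(Λ₅⁽ᵏ⁻¹⁾)`, p. 567), if the
support of `θ_{k+2}` and one fine step around it lie inside `Bᵏ(Λ₅⁽ᵏ⁾)` (`hzero`; print: an M-slice around
`Bᵏ⁺¹(Λ₂⁽ᵏ⁺¹⁾) ⊂ Bᵏ(Λ₅⁽ᵏ⁾)`, pp. 566–567), and `θ_m = 0` for `m > K` (`habove`), then at every `z ∈ Bᵏ(Λ_k)`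
(`Λ_k = Λ₅⁽ᵏ⁻¹⁾′ ∩ Λ₅⁽ᵏ⁾ᶜ`): `θ_k(z) = θ_k(z+εe_ν) = 1` and `θ_{k+2}(z) = θ_{k+2}(z+εe_ν) = 0`.
[cite: Balaban1982Higgs2, p.567, (3.24) p.588, (3.29) p.590] -/
theorem slice_pattern_of_tower
    (hone : ∀ k, 1 ≤ k → k ≤ K → ∀ z : HiggsLattice.Site P 0, T.lamAt (k - 1) z →
      θ k z = 1 ∧ ∀ ν, θ k (z.shift ν) = 1)
    (hzero : ∀ k, k + 2 ≤ K → ∀ z : HiggsLattice.Site P 0,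
      (θ (k + 2) z ≠ 0 ∨ ∃ ν, θ (k + 2) (z.shift ν) ≠ 0) → T.lamAt k z)
    (habove : ∀ m, K < m → ∀ z : HiggsLattice.Site P 0, θ m z = 0)
    (j : Fin K) (z : HiggsLattice.Site P 0) (hz : z ∈ pieceF T.regions j) (ν : Fin P.d) :
    θ (j.val + 1) z = 1 ∧ θ (j.val + 1) (z.shift ν) = 1 ∧ θ (j.val + 3) z = 0 ∧ θ (j.val + 3) (z.shift ν) = 0 := by
  rw [mem_pieceF, T.inPiece_regions_iff] at hz
  obtain ⟨hin, hout⟩ := hz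
  obtain ⟨h1, h1s⟩ := hone (j.val + 1) (by omega) (by omega) z (by simpa using hin)
  refine ⟨h1, h1s ν, ?_, ?_⟩
  · by_cases hK : j.val + 3 ≤ K
    · by_contra hne
      exact hout (hzero (j.val + 1) (by omega) z (Or.inl hne))
    · exact habove _ (by omega) z
  · by_cases hK : j.val + 3 ≤ K
    · by_contra hne
      exact hout (hzero (j.val + 1) (by omega) z (Or.inr ⟨ν, hne⟩))
    · exact habove _ (by omega) (z.shift ν)

/-- **THE REGULARITY OF THE §3 FIELD `Ã^ε` (3.2) ON EVERY `Bᵏ(Λ_k)`, `k = 1, …, K`, DERIVED** — in the exact shape of the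
hypothesis `hreg` of `B2Ineq329RegularField.prop31_regular_tower` (= [Balaban1983RegularityDecay] Prop. 3.1′ (1.21) for the
field of (3.29), in physical units).  INPUTS (printed): nesting and range `0 ≤ θ ≤ 1` of the cut-offs, their geometry relative
to the tower (`hone`, `hzero`, `habove`, see `slice_pattern_of_tower`) and smoothness `|θ_{k+1}(z+εe_ν) − θ_{k+1}(z)| ≤ ϑ_j`
(*"varies "smoothly" from 1 to 0 on a slice of thickness < M"*, p. 567; `|∂θ| ≤ O(1)` in (2.96)–(2.98)); Lemma 2.3 (2.59)
`|A^{(k),ε}(⟨z,μ⟩) − A_k(z_k)_μ| ≤ α_j` and (2.60) `|A^{(k),ε}(⟨z+εe_ν,μ⟩) − A^{(k),ε}(⟨z,μ⟩)| ≤ γ_j` on `Bᵏ(Λ_k)`, and, on the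
`θ_{k+1}`-slice only, the same for `A^{(k+1),ε}` (`α′_j`, `γ′_j`) together with the restriction `|A_{k+1}(z_{k+1})_μ − A_k(z_k)_μ| ≤ β_j`
((2.17) p. 560 / (2.97) p. 577); reference values `ak k z μ` ↤ `A_k(z_k)_μ`.  CONCLUSION: for every `δ` with
`ϑ_j(α_j + α′_j + β_j) + max(γ_j, γ′_j) ≤ δ_j`, `|Ã^ε(⟨z+εe_ν,μ⟩) − Ã^ε(⟨z,μ⟩)| ≤ δ_j` for all `z ∈ Bᵏ(Λ_k)`, `μ`, `ν`
(*"|(∂B̃)(x)| ≦ O(1)p(Lʲε) (2.98) and it means that the regularity assumption is satisfied"*, p. 577).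
[cite: Balaban1982Higgs2, (3.2) p.583, (2.95)–(2.98) pp.576–577, Lemma 2.3 (2.59)–(2.60) p.571, Prop. 3.1 p.589] -/
theorem field32_regular_tower (hθ : Nested θ) (hrange : ∀ m (z : HiggsLattice.Site P 0), 0 ≤ θ m z ∧ θ m z ≤ 1)
    (hone : ∀ k, 1 ≤ k → k ≤ K → ∀ z : HiggsLattice.Site P 0, T.lamAt (k - 1) z →
      θ k z = 1 ∧ ∀ ν, θ k (z.shift ν) = 1)
    (hzero : ∀ k, k + 2 ≤ K → ∀ z : HiggsLattice.Site P 0,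
      (θ (k + 2) z ≠ 0 ∨ ∃ ν, θ (k + 2) (z.shift ν) ≠ 0) → T.lamAt k z)
    (habove : ∀ m, K < m → ∀ z : HiggsLattice.Site P 0, θ m z = 0)
    (ak : ℕ → HiggsLattice.Site P 0 → Fin P.d → ℝ) {ϑ α α' β γ γ' δ : Fin K → ℝ}
    (hϑ : ∀ j, 0 ≤ ϑ j) (hα : ∀ j, 0 ≤ α j) (hα' : ∀ j, 0 ≤ α' j) (hβ : ∀ j, 0 ≤ β j)
    (hdθ : ∀ (j : Fin K), ∀ z ∈ pieceF T.regions j, ∀ ν : Fin P.d,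
      |θ (j.val + 2) (z.shift ν) - θ (j.val + 2) z| ≤ ϑ j)
    (h259 : ∀ (j : Fin K), ∀ z ∈ pieceF T.regions j, ∀ μ : Fin P.d, |A (j.val + 1) ⟨z, μ⟩ - ak (j.val + 1) z μ| ≤ α j)
    (h260 : ∀ (j : Fin K), ∀ z ∈ pieceF T.regions j, ∀ μ ν : Fin P.d,
      |A (j.val + 1) ⟨z.shift ν, μ⟩ - A (j.val + 1) ⟨z, μ⟩| ≤ γ j)
    (h259' : ∀ (j : Fin K), ∀ z ∈ pieceF T.regions j, ∀ μ ν : Fin P.d,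
      (θ (j.val + 2) z ≠ 0 ∨ θ (j.val + 2) (z.shift ν) ≠ 0) → |A (j.val + 2) ⟨z, μ⟩ - ak (j.val + 2) z μ| ≤ α' j)
    (hrestr : ∀ (j : Fin K), ∀ z ∈ pieceF T.regions j, ∀ μ ν : Fin P.d,
      (θ (j.val + 2) z ≠ 0 ∨ θ (j.val + 2) (z.shift ν) ≠ 0) → |ak (j.val + 2) z μ - ak (j.val + 1) z μ| ≤ β j)
    (h260' : ∀ (j : Fin K), ∀ z ∈ pieceF T.regions j, ∀ μ ν : Fin P.d,
      (θ (j.val + 2) z ≠ 0 ∨ θ (j.val + 2) (z.shift ν) ≠ 0) →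
        |A (j.val + 2) ⟨z.shift ν, μ⟩ - A (j.val + 2) ⟨z, μ⟩| ≤ γ' j)
    (hδ : ∀ j, ϑ j * (α j + α' j + β j) + max (γ j) (γ' j) ≤ δ j) :
    ∀ (j : Fin K), ∀ z ∈ pieceF T.regions j, ∀ μ' ν : Fin P.d,
      |field32 θ A₀ A K ⟨z.shift ν, μ'⟩ - field32 θ A₀ A K ⟨z, μ'⟩| ≤ δ j := by
  intro j z hz μ' ν
  obtain ⟨h1, h1', h0, h0'⟩ := slice_pattern_of_tower T θ hone hzero habove j z hz ν
  refine le_trans ?_ (hδ j)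
  by_cases htop : j.val + 2 ≤ K
  · -- `k = j+1 ≤ K − 1`: the two-scale slice
    exact field32_regular_slice θ A₀ A hθ (k := j.val + 1) (by omega) htop z μ' ν h1 h0 h1' h0'
      (hrange _ _).1 (hrange _ _).2 (hϑ j) (hα j) (hα' j) (hβ j) (hdθ j z hz ν) (h259 j z hz μ')
      (h259' j z hz μ' ν) (hrestr j z hz μ' ν) (h260 j z hz μ' ν) (h260' j z hz μ' ν)
  · -- `k = K`: the top scale
    have hjK : j.val + 1 = K := by omega
    have htop' := field32_regular_top θ A₀ A hθ (K := K) (by omega) z μ' ν (by rw [← hjK]; exact h1)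
      (by rw [← hjK]; exact h1') (γ := γ j) (by rw [← hjK]; exact h260 j z hz μ' ν)
    have hbig : 0 ≤ ϑ j * (α j + α' j + β j) := mul_nonneg (hϑ j) (by linarith [hα j, hα' j, hβ j])
    linarith [le_max_left (γ j) (γ' j)]

end TowerReg

end Literature.MathematicalPhysics.QuantumFieldTheory.Balaban1983to89.B2Eq32FieldRegularity

end
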